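import Summits.AtomisticToContinuum.Crystallization.Theses.PalmUnimodularRigidity
import Summits.AtomisticToContinuum.Crystallization.Theorems.MinimiserShells.Negative.LoadBearing
import Summits.AtomisticToContinuum.Crystallization.Theorems.PalmUnimodularRigidityMinimiserShellsEquilibriumInLawCluster
import Literature.MathematicalPhysics.StatisticalMechanics.LennardJonesClusters
import Literature.MathematicalPhysics.StatisticalMechanics.MuGSC

/-!
# Removal-minimal finite Lennard-Jones configurations are `1/3`-separated (stub S15b, reshape r6)

Stub `stub_sepReduction_separated` (S15b) of line `equilibrium-in-law-surgery` (reshape r6, the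
hard-core reduction) of crux `MinimiserShells` (stmt-AtomisticToContinuum-9225, route
`PalmUnimodularRigidity`).

A finite set `Z ⊆ ℝ³` whose Lennard-Jones half double sum `½ ∑_{a ∈ Z} ∑_{b ∈ Z} V_LJ(|a − b|)`
does not decrease under removal of any single point is `1/3`-SEPARATED.

Proof (the computation of `LennardJonesMinimalDistance_holds` of
`Literature/MathematicalPhysics/StatisticalMechanics/LennardJonesClusters.lean`, transplanted from
ground states to removal-minimal finite sets).

* `sum_sum_eq_sum_sum_erase_add` — expanding the double sum of a symmetric kernel at a point `x`:
  `∑∑_Z f = ∑∑_{Z ∖ x} f + 2 ∑_{b ∈ Z ∖ x} f x b + f x x`;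
* `sum_erase_lennardJones_nonpos` — hence (`V_LJ(0) = 0`) removal-minimality says that every
  SITE SUM `∑_{b ∈ Z ∖ x} V_LJ(|x − b|)` is `≤ 0`;
* `stub_sepReduction_separated` — at a closest pair `(x₀, z₀)` of distinct points of `Z`,
  `r = |x₀ − z₀|`, all distinct points of `Z` are `≥ r` apart, so the shell sum
  (`sum_inv_pow_six_le_of_le_dist`, the Finset form of `sum_inv_pow_six_le`) gives
  `∑_{b ∈ Z ∖ x₀} |x₀ − b|⁻⁶ ≤ 250 r⁻⁶`, while `∑_{b ∈ Z ∖ x₀} |x₀ − b|⁻¹² ≥ r⁻¹²`; thus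
  `0 ≥ site sum of x₀ ≥ r⁻¹²/12 − (250/6) r⁻⁶`, i.e. `r⁻⁶ ≤ 500 < 729 = 3⁶`, so `r ≥ 1/3`
  (contradiction if some pair were closer than `1/3`).
-/

noncomputable section

open scoped BigOperators Classical

namespace Summit.AtomisticToContinuum.Crystallization.Theorems.PalmUnimodularRigidityMinimiserShells.SepReduction

open Literature.MathematicalPhysics.StatisticalMechanics (lennardJones lennardJones_zero
  sum_inv_pow_six_le_of_le_dist)

/-! ## Expanding a double sum at a point -/

/-- **Expansion of a symmetric double sum at a point.** For a symmetric kernel `f` and `x ∈ Z`: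
`∑_{a ∈ Z} ∑_{b ∈ Z} f a b = ∑_{a ∈ Z ∖ x} ∑_{b ∈ Z ∖ x} f a b + 2 ∑_{b ∈ Z ∖ x} f x b + f x x`
(row `x`, column `x`, the diagonal term, and the rest). -/
theorem sum_sum_eq_sum_sum_erase_add {α : Type*} [DecidableEq α] (Z : Finset α) {x : α}
    (hx : x ∈ Z) (f : α → α → ℝ) (hf : ∀ a b, f a b = f b a) :
    ∑ a ∈ Z, ∑ b ∈ Z, f a b =
      ∑ a ∈ Z.erase x, ∑ b ∈ Z.erase x, f a b + 2 * ∑ b ∈ Z.erase x, f x b + f x x := by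
  rw [← Finset.add_sum_erase Z _ hx, ← Finset.add_sum_erase Z _ hx]
  have h : ∀ a ∈ Z.erase x, ∑ b ∈ Z, f a b = f x a + ∑ b ∈ Z.erase x, f a b := fun a _ => by
    rw [← Finset.add_sum_erase Z _ hx, hf a x]
  rw [Finset.sum_congr rfl h, Finset.sum_add_distrib]
  ring

/-! ## Site sums of removal-minimal configurations -/

/-- **Removal-minimality means non-positive site sums.** If the Lennard-Jones half double sum of a
finite `Z ⊆ ℝ³` does not decrease when any single point is removed, then for every `x ∈ Z` the site
sum `∑_{b ∈ Z ∖ x} V_LJ(|x − b|)` is `≤ 0` (expand the double sum at `x`; the diagonal term is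
`V_LJ(0) = 0`). -/
theorem sum_erase_lennardJones_nonpos (Z : Finset (EuclideanSpace ℝ (Fin 3)))
    (hZ : ∀ x ∈ Z, (∑ a ∈ Z, ∑ b ∈ Z, lennardJones (dist a b)) / 2 ≤
      (∑ a ∈ Z.erase x, ∑ b ∈ Z.erase x, lennardJones (dist a b)) / 2)
    {x : EuclideanSpace ℝ (Fin 3)} (hx : x ∈ Z) :
    ∑ b ∈ Z.erase x, lennardJones (dist x b) ≤ 0 := by
  have h := hZ x hx
  rw [sum_sum_eq_sum_sum_erase_add Z hx (fun a b => lennardJones (dist a b))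
    (fun a b => by rw [dist_comm]), dist_self, lennardJones_zero] at h
  linarith

/-- The site sum splits into the repulsive and the attractive parts:
`∑_{b ∈ t} V_LJ(|x − b|) = (1/12) ∑_{b ∈ t} |x − b|⁻¹² − (1/6) ∑_{b ∈ t} |x − b|⁻⁶`. -/
theorem sum_lennardJones_eq (t : Finset (EuclideanSpace ℝ (Fin 3))) (x : EuclideanSpace ℝ (Fin 3)) :
    ∑ b ∈ t, lennardJones (dist x b) =
      (1 / 12) * ∑ b ∈ t, (dist x b)⁻¹ ^ 12 - (1 / 6) * ∑ b ∈ t, (dist x b)⁻¹ ^ 6 := by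
  simp only [lennardJones, Finset.sum_sub_distrib, Finset.mul_sum]

/-! ## The stub -/

/-- **Removal-minimal finite Lennard-Jones configurations are `1/3`-separated** (stub S15b).  If the
half double sum `½ ∑_{a ∈ Z} ∑_{b ∈ Z} V_LJ(|a − b|)` of a finite `Z ⊆ ℝ³` does not decrease under
removal of any single point, then distinct points of `Z` are at distance `≥ 1/3`: at a closest pair
`(x₀, z₀)`, `r = |x₀ − z₀|`, the site sum of `x₀` is `≤ 0` (`sum_erase_lennardJones_nonpos`) and
`≥ r⁻¹²/12 − (250/6) r⁻⁶` (shell sum `sum_inv_pow_six_le_of_le_dist`, all points of `Z` being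
pairwise `≥ r` apart), whence `r⁻⁶ ≤ 500 < 3⁶` — the computation of
`LennardJonesMinimalDistance_holds`. -/
theorem stub_sepReduction_separated :
    ∀ Z : Finset (EuclideanSpace ℝ (Fin 3)),
      (∀ x ∈ Z, (∑ a ∈ Z, ∑ b ∈ Z, lennardJones (dist a b)) / 2 ≤
        (∑ a ∈ Z.erase x, ∑ b ∈ Z.erase x, lennardJones (dist a b)) / 2) →
      ∀ x ∈ Z, ∀ z ∈ Z, x ≠ z → (1 : ℝ) / 3 ≤ dist x z := by
  intro Z hZ x hx z hz hxz
  by_contra hlt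
  rw [not_le] at hlt
  -- a closest pair `(x₀, z₀)` of distinct points of `Z`
  obtain ⟨p, hp, hmin⟩ := Finset.exists_min_image Z.offDiag
    (fun p : EuclideanSpace ℝ (Fin 3) × EuclideanSpace ℝ (Fin 3) => dist p.1 p.2)
    ⟨(x, z), Finset.mem_offDiag.2 ⟨hx, hz, hxz⟩⟩
  obtain ⟨x₀, z₀⟩ := p
  obtain ⟨hx₀, hz₀, hne⟩ := Finset.mem_offDiag.1 hp
  set r := dist x₀ z₀ with hr_def
  have hr : 0 < r := dist_pos.2 hne
  have hsep : ∀ a ∈ Z, ∀ b ∈ Z, a ≠ b → r ≤ dist a b := fun a ha b hb hab =>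
    hmin (a, b) (Finset.mem_offDiag.2 ⟨ha, hb, hab⟩)
  have hr3 : r < 1 / 3 := (hsep x hx z hz hxz).trans_lt hlt
  -- the site sum of `x₀`: `≤ 0` by removal-minimality ...
  have h0 := sum_erase_lennardJones_nonpos Z hZ hx₀
  -- ... and `≥ r⁻¹²/12 - (250/6) r⁻⁶` by the shell sum
  have hS : ∑ b ∈ Z.erase x₀, (dist x₀ b)⁻¹ ^ 6 ≤ 250 * r⁻¹ ^ 6 :=
    sum_inv_pow_six_le_of_le_dist (Z.erase x₀) x₀ hr
      (fun b hb => hsep x₀ hx₀ b (Finset.mem_of_mem_erase hb) (Finset.ne_of_mem_erase hb).symm)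
      (fun b hb c hc hbc =>
        hsep b (Finset.mem_of_mem_erase hb) c (Finset.mem_of_mem_erase hc) hbc)
  have h12 : r⁻¹ ^ 12 ≤ ∑ b ∈ Z.erase x₀, (dist x₀ b)⁻¹ ^ 12 := by
    have hz₀' : z₀ ∈ Z.erase x₀ := Finset.mem_erase.2 ⟨hne.symm, hz₀⟩
    exact Finset.single_le_sum (f := fun b => (dist x₀ b)⁻¹ ^ 12) (fun b _ => by positivity) hz₀'
  have hexp := sum_lennardJones_eq (Z.erase x₀) x₀
  -- numerics: `r⁻⁶ > 3⁶ = 729 > 500`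
  have hu : (729 : ℝ) < r⁻¹ ^ 6 := by
    have h3 : 3 < r⁻¹ := by
      rw [lt_inv_comm₀ (by norm_num) hr]
      have : (3 : ℝ)⁻¹ = 1 / 3 := by norm_num
      linarith
    calc (729 : ℝ) = 3 ^ 6 := by norm_num
      _ < r⁻¹ ^ 6 := pow_lt_pow_left₀ h3 (by norm_num) (by norm_num)
  have h12' : r⁻¹ ^ 12 = (r⁻¹ ^ 6) ^ 2 := by ring
  have hu' : 729 * r⁻¹ ^ 6 < r⁻¹ ^ 6 * r⁻¹ ^ 6 := mul_lt_mul_of_pos_right hu (by linarith)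
  rw [h12', sq] at h12
  linarith

end Summit.AtomisticToContinuum.Crystallization.Theorems.PalmUnimodularRigidityMinimiserShells.SepReduction

end
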